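import Summits.ValiantsHypothesis.ValiantsHypothesis.Theorems.KPlusLogSqLawTropicalBTwoBoundaryPortDefs
import Summits.ValiantsHypothesis.ValiantsHypothesis.Theorems.KPlusLogSqLawTropicalShiftThreeChain

/-!
# Route «KPlusLogSqLaw», crux `TropicalB` (stmt-ValiantsHypothesis-19771) — the TWO-BOUNDARY PORT of SHIFT-THREE, part 1:
# entry classes, valuations, the term map, SHIFT-THREE facts

HONEST FRAMING.  Proof file (pure theorems) of the helper chain `…TwoBoundaryPortDefs` → this file → `…TwoBoundaryQuadratic`
toward the registered stubs `stub_tropThin` / `stub_tropFat` of `Cruxes/TropicalB/Lines/birth.lean` (crux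
`Summit.ValiantsHypothesis.ValiantsHypothesis.Theses.KPlusLogSqLaw.TropicalB`, item `stmt-ValiantsHypothesis-19771`, route `KPlusLogSqLaw`;
cell `pub-symmetroid`, seat val-sym-trop-p1 g17, 2026-08-28; `--supports … --as helper`).  A STRUCTURE result about the boundary-type
(«permutation register») SECTOR of val-sym-trop-p1 g2 (`BoundarySector.IsBoundaryDesign` / `BoundaryVertexLaw`, p447010): nothing here
bounds `TropicalB` in its window, and nothing bears on `WeakLifting`, DoorA26 / DoorA34, `MatrixDescartes` (stmt-ValiantsHypothesis-18050) or
VP ≠ VNP.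

THIS FILE.  For the dense two-boundary design `(bd, lab3, dd, bigV, bigE)` of the definitions file (size `2m`, `m = n + 1`):
* the four kinds of entries and their pattern classes (`lab_rr` wrap class, `lab_pr = 1`, `lab_rp = 0`, `lab_pp`), the valuations
  (`bigV_rr/pr/rp/pp`) and `isBoundaryDesign_big : IsBoundaryDesign (bd n) (bd n) lab3 (bigE n)`;
* the values of the term map `bigPerm` / `bigCls` on real and partner columns, toggled (`μ b = 1`) or not;
* the SHIFT-THREE facts the certificate needs: presence pins the wrap bit (`wrap_iff_two_of_ee`), the wrap class and the
  non-wrapping class `1` are present, the entrywise redistribution identity `(2m+3)·shift − D·[wrap] = (2m+3)(a − b)` (`redistrib`, so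
  `phi = θ·d − v + θ(2m+3)(a − b)`, `phi_eq`: SHIFT-THREE's corrected score is the entry score plus a ROW potential minus a COLUMN
  potential), `phi_one_lt_phi_two` (class `1` always loses to class `2` on the same cell at positive slope), `lam_eq_wrapClass`.
Part 2 (`…TwoBoundaryQuadratic`) turns SHIFT-THREE's per-entry domination (`ShiftThree.phi_le/phi_lt`, val-sym-lift-p3) into a scale-2 dual
certificate for every grid term of the port and concludes `¬ BoundaryVertexLaw 2 1`.
-/

set_option linter.dupNamespace false
set_option autoImplicit false

namespace Summit.ValiantsHypothesis.ValiantsHypothesis.Theorems.KPlusLogSqLaw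

namespace BoundarySector

namespace TwoPort

open Summit.ValiantsHypothesis.ValiantsHypothesis.Theorems.MatrixDescartes.Negative
open Summit.ValiantsHypothesis.ValiantsHypothesis.Theorems.LacunarySymmetroidMatrixDescartes.TropicalCensus
open Summit.ValiantsHypothesis.ValiantsHypothesis.Theorems.LacunarySymmetroidMatrixDescartes.TropicalCensus.ShiftThree

variable (n : ℕ)

/-! ### 1. The four kinds of entries and their classes -/

/-- a real index decodes to `inl`. -/
theorem symm_RE (a : Fin (n + 1)) : finSumFinEquiv.symm ((Fin.castAdd (n + 1)) a) = Sum.inl a :=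
  finSumFinEquiv_symm_apply_castAdd a

/-- a partner index decodes to `inr`. -/
theorem symm_PA (b : Fin (n + 1)) : finSumFinEquiv.symm ((Fin.natAdd (n + 1)) b) = Sum.inr b :=
  finSumFinEquiv_symm_apply_natAdd b

/-- the half-swap sends real to partner. -/
theorem flip_RE (a : Fin (n + 1)) : finAddFlip ((Fin.castAdd (n + 1)) a) = (Fin.natAdd (n + 1)) a := finAddFlip_apply_castAdd a (n + 1)

/-- the half-swap sends partner to real. -/
theorem flip_PA (b : Fin (n + 1)) : finAddFlip ((Fin.natAdd (n + 1)) b) = (Fin.castAdd (n + 1)) b := finAddFlip_apply_natAdd b (n + 1)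

/-- value of a real index. -/
theorem val_RE (a : Fin (n + 1)) : (((Fin.castAdd (n + 1)) a : Fin ((n + 1) + (n + 1))) : ℕ) = a := rfl

/-- value of a partner index. -/
theorem val_PA (b : Fin (n + 1)) : (((Fin.natAdd (n + 1)) b : Fin ((n + 1) + (n + 1))) : ℕ) = (n + 1) + b := rfl

/-- boundary `0` is the identity key pair. -/
theorem bd_zero : bd n 0 = 1 := rfl

/-- boundary `1` is the half-swap key pair. -/
theorem bd_one : bd n 1 = finAddFlip := rfl

/-- class of a real/real entry: the wrap class. -/
theorem lab_rr (a b : Fin (n + 1)) :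
    lab3 (pattern (bd n) (bd n) ((Fin.castAdd (n + 1)) a) ((Fin.castAdd (n + 1)) b)) = if (a : ℕ) < (b : ℕ) then 2 else 0 := by
  unfold lab3 pattern
  have e0 : ((bd n 0) ((Fin.castAdd (n + 1)) a) < (bd n 0) ((Fin.castAdd (n + 1)) b)) ↔ (a : ℕ) < (b : ℕ) := by
    rw [bd_zero, Equiv.Perm.coe_one, id_eq, id_eq, Fin.lt_def, val_RE, val_RE]
  have e1 : ((bd n 1) ((Fin.castAdd (n + 1)) a) < (bd n 1) ((Fin.castAdd (n + 1)) b)) ↔ (a : ℕ) < (b : ℕ) := by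
    rw [bd_one, flip_RE, flip_RE, Fin.lt_def, val_PA, val_PA]; omega
  simp only [e0, e1]
  by_cases h : (a : ℕ) < (b : ℕ) <;> simp [h]

/-- class of the entry (partner row `b'`, real column `b`): `1`. -/
theorem lab_pr (b' b : Fin (n + 1)) : lab3 (pattern (bd n) (bd n) ((Fin.natAdd (n + 1)) b') ((Fin.castAdd (n + 1)) b)) = 1 := by
  unfold lab3 pattern
  have e0 : ¬ ((bd n 0) ((Fin.natAdd (n + 1)) b') < (bd n 0) ((Fin.castAdd (n + 1)) b)) := by
    rw [bd_zero, Equiv.Perm.coe_one, id_eq, id_eq, Fin.lt_def, val_PA, val_RE]; omega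
  have e1 : ((bd n 1) ((Fin.natAdd (n + 1)) b') < (bd n 1) ((Fin.castAdd (n + 1)) b)) := by
    rw [bd_one, flip_PA, flip_RE, Fin.lt_def, val_RE, val_PA]; omega
  simp only [e0, e1, decide_false, decide_true]
  simp

/-- class of the entry (real row `a`, partner column `c`): `0`. -/
theorem lab_rp (a c : Fin (n + 1)) : lab3 (pattern (bd n) (bd n) ((Fin.castAdd (n + 1)) a) ((Fin.natAdd (n + 1)) c)) = 0 := by
  unfold lab3 pattern
  have e0 : ((bd n 0) ((Fin.castAdd (n + 1)) a) < (bd n 0) ((Fin.natAdd (n + 1)) c)) := by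
    rw [bd_zero, Equiv.Perm.coe_one, id_eq, id_eq, Fin.lt_def, val_RE, val_PA]; omega
  have e1 : ¬ ((bd n 1) ((Fin.castAdd (n + 1)) a) < (bd n 1) ((Fin.natAdd (n + 1)) c)) := by
    rw [bd_one, flip_RE, flip_PA, Fin.lt_def, val_PA, val_RE]; omega
  simp only [e0, e1, decide_false, decide_true]
  simp

/-- class of a partner/partner entry `(b', c)`: `2` if `b' < c`, else `0`. -/
theorem lab_pp (b' c : Fin (n + 1)) :
    lab3 (pattern (bd n) (bd n) ((Fin.natAdd (n + 1)) b') ((Fin.natAdd (n + 1)) c)) = if (b' : ℕ) < (c : ℕ) then 2 else 0 := by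
  unfold lab3 pattern
  have e0 : ((bd n 0) ((Fin.natAdd (n + 1)) b') < (bd n 0) ((Fin.natAdd (n + 1)) c)) ↔ (b' : ℕ) < (c : ℕ) := by
    rw [bd_zero, Equiv.Perm.coe_one, id_eq, id_eq, Fin.lt_def, val_PA, val_PA]; omega
  have e1 : ((bd n 1) ((Fin.natAdd (n + 1)) b') < (bd n 1) ((Fin.natAdd (n + 1)) c)) ↔ (b' : ℕ) < (c : ℕ) := by
    rw [bd_one, flip_PA, flip_PA, Fin.lt_def, val_RE, val_RE]
  simp only [e0, e1]
  by_cases h : (b' : ℕ) < (c : ℕ) <;> simp [h]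

/-! ### 2. Values of the valuations -/

/-- valuation of a real/real entry: SHIFT-THREE's. -/
theorem bigV_rr (a b : Fin (n + 1)) (l : Fin 3) : bigV n ((Fin.castAdd (n + 1)) a) ((Fin.castAdd (n + 1)) b) l = vv n a b l := by
  unfold bigV; rw [symm_RE, symm_RE, valS]

/-- valuation of a partner-row / real-column entry: `0` on the toggle cell, `huge` elsewhere. -/
theorem bigV_pr (b' b : Fin (n + 1)) (l : Fin 3) : bigV n ((Fin.natAdd (n + 1)) b') ((Fin.castAdd (n + 1)) b) l = if b' = b then 0 else huge n := by
  unfold bigV; rw [symm_PA, symm_RE, valS]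

/-- valuation of a real-row / partner-column entry: the class-`1` valuation of the cell it stands in for. -/
theorem bigV_rp (a c : Fin (n + 1)) (l : Fin 3) : bigV n ((Fin.castAdd (n + 1)) a) ((Fin.natAdd (n + 1)) c) l = vv n a c 1 := by
  unfold bigV; rw [symm_RE, symm_PA, valS]

/-- valuation of a partner/partner entry: `0` at home, `huge` elsewhere. -/
theorem bigV_pp (b' c : Fin (n + 1)) (l : Fin 3) : bigV n ((Fin.natAdd (n + 1)) b') ((Fin.natAdd (n + 1)) c) l = if b' = c then 0 else huge n := by
  unfold bigV; rw [symm_PA, symm_PA, valS]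

/-- the design is boundary-type with the two boundaries `bd` and the labelling `lab3`, by construction. -/
theorem isBoundaryDesign_big : IsBoundaryDesign (bd n) (bd n) lab3 (bigE n) := by
  intro x y l
  unfold bigE
  constructor
  · intro h; by_contra hl; exact h (by rw [if_neg hl])
  · intro h; rw [if_pos h]; exact one_ne_zero

/-! ### 3. Values of the big term -/

variable (σ : Equiv.Perm (Fin (n + 1))) (μ : Fin (n + 1) → Fin 3)

/-- an untoggled real column sits on the real row `σ b`. -/
theorem bigPerm_re_of_ne (b : Fin (n + 1)) (h : μ b ≠ 1) : bigPerm n σ μ ((Fin.castAdd (n + 1)) b) = (Fin.castAdd (n + 1)) (σ b) := by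
  simp only [bigPerm, toggle, Equiv.trans_apply, symm_RE, Function.Involutive.coe_toPerm, toggleFun, if_neg h,
    Equiv.sumCongr_apply, Sum.map_inl, finSumFinEquiv_apply_left]

/-- a toggled real column sits on its partner row. -/
theorem bigPerm_re_of_eq (b : Fin (n + 1)) (h : μ b = 1) : bigPerm n σ μ ((Fin.castAdd (n + 1)) b) = (Fin.natAdd (n + 1)) b := by
  simp only [bigPerm, toggle, Equiv.trans_apply, symm_RE, Function.Involutive.coe_toPerm, toggleFun, if_pos h,
    Equiv.sumCongr_apply, Sum.map_inr, Equiv.coe_refl, id_eq, finSumFinEquiv_apply_right]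

/-- an untoggled partner column sits at home. -/
theorem bigPerm_pa_of_ne (b : Fin (n + 1)) (h : μ b ≠ 1) : bigPerm n σ μ ((Fin.natAdd (n + 1)) b) = (Fin.natAdd (n + 1)) b := by
  simp only [bigPerm, toggle, Equiv.trans_apply, symm_PA, Function.Involutive.coe_toPerm, toggleFun, if_neg h,
    Equiv.sumCongr_apply, Sum.map_inr, Equiv.coe_refl, id_eq, finSumFinEquiv_apply_right]

/-- a toggled partner column sits on the real row `σ b`. -/
theorem bigPerm_pa_of_eq (b : Fin (n + 1)) (h : μ b = 1) : bigPerm n σ μ ((Fin.natAdd (n + 1)) b) = (Fin.castAdd (n + 1)) (σ b) := by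
  simp only [bigPerm, toggle, Equiv.trans_apply, symm_PA, Function.Involutive.coe_toPerm, toggleFun, if_pos h,
    Equiv.sumCongr_apply, Sum.map_inl, finSumFinEquiv_apply_left]

/-- class of an untoggled real column: the wrap class. -/
theorem bigCls_re_of_ne (b : Fin (n + 1)) (h : μ b ≠ 1) :
    bigCls n σ μ ((Fin.castAdd (n + 1)) b) = if ((σ b : Fin (n + 1)) : ℕ) < (b : ℕ) then 2 else 0 := by
  unfold bigCls; rw [bigPerm_re_of_ne n σ μ b h, lab_rr]

/-- class of a toggled real column: `1`. -/
theorem bigCls_re_of_eq (b : Fin (n + 1)) (h : μ b = 1) : bigCls n σ μ ((Fin.castAdd (n + 1)) b) = 1 := by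
  unfold bigCls; rw [bigPerm_re_of_eq n σ μ b h, lab_pr]

/-- class of an untoggled partner column: `0`. -/
theorem bigCls_pa_of_ne (b : Fin (n + 1)) (h : μ b ≠ 1) : bigCls n σ μ ((Fin.natAdd (n + 1)) b) = 0 := by
  unfold bigCls; rw [bigPerm_pa_of_ne n σ μ b h, lab_pp]; simp

/-- class of a toggled partner column: `0`. -/
theorem bigCls_pa_of_eq (b : Fin (n + 1)) (h : μ b = 1) : bigCls n σ μ ((Fin.natAdd (n + 1)) b) = 0 := by
  unfold bigCls; rw [bigPerm_pa_of_eq n σ μ b h, lab_rp]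

/-! ### 4. SHIFT-THREE facts -/

/-- presence in SHIFT-THREE pins the wrap bit: a present entry has class `2` iff it wraps. -/
theorem wrap_iff_two_of_ee {a b : Fin (n + 1)} {l : Fin 3} (h : ee n a b l ≠ 0) : ((a : ℕ) < (b : ℕ) ↔ l = 2) := by
  unfold ee at h
  by_cases hw : (a : ℕ) < (b : ℕ)
  · rw [if_pos hw] at h
    refine ⟨fun _ => ?_, fun _ => hw⟩
    by_contra hl; exact h (by rw [if_neg hl])
  · rw [if_neg hw] at h
    refine ⟨fun h' => absurd h' hw, fun hl => ?_⟩
    subst hl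
    exact absurd (by rw [if_neg (by decide), if_neg (by decide)]) h

/-- the wrap class of an entry is present in SHIFT-THREE. -/
theorem ee_wrapClass_ne_zero (a b : Fin (n + 1)) : ee n a b (if (a : ℕ) < (b : ℕ) then 2 else 0) ≠ 0 := by
  unfold ee
  by_cases hw : (a : ℕ) < (b : ℕ)
  · rw [if_pos hw, if_pos hw, if_pos rfl]
    split_ifs
    · exact phaseSign_ne_zero n _
    · exact one_ne_zero
  · rw [if_neg hw, if_neg hw, if_pos rfl]; exact one_ne_zero

/-- class `1` is present on non-wrapping entries. -/
theorem ee_one_ne_zero {a b : Fin (n + 1)} (hw : ¬ (a : ℕ) < (b : ℕ)) : ee n a b 1 ≠ 0 := by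
  unfold ee; rw [if_neg hw, if_neg (by decide), if_pos rfl]; norm_num

/-- the redistribution identity entrywise: `(2m+3)·shift − D·[wrap] = (2m+3)(a − b)`. -/
theorem redistrib (a b : Fin (n + 1)) :
    (2 * (n : ℤ) + 5) * shiftZ n a b - (bigD n : ℤ) * (if (a : ℕ) < (b : ℕ) then 1 else 0) =
      (2 * (n : ℤ) + 5) * ((a : ℤ) - (b : ℤ)) := by
  unfold shiftZ bigD
  by_cases hw : (a : ℕ) < (b : ℕ)
  · rw [if_pos hw, if_pos hw]; push_cast; ring
  · rw [if_neg hw, if_neg hw]; ring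

/-- `phi` as entry score plus a row potential minus a column potential. -/
theorem phi_eq (θ : ℤ) (a b : Fin (n + 1)) (l : Fin 3) :
    phi n θ a b l = θ * (dd n l : ℤ) - vv n a b l + θ * (2 * (n : ℤ) + 5) * ((a : ℤ) - (b : ℤ)) := by
  have h := redistrib n a b
  unfold phi
  linear_combination θ * h

/-- shifts are non-negative. -/
theorem shiftZ_nonneg (a b : Fin (n + 1)) : 0 ≤ shiftZ n a b := by
  unfold shiftZ; split_ifs <;> omega

/-- shifts are at most `n`. -/
theorem shiftZ_le (a b : Fin (n + 1)) : shiftZ n a b ≤ n := by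
  unfold shiftZ; split_ifs <;> omega

/-- class-`1` prices are positive. -/
theorem price_pos (a b : Fin (n + 1)) : 0 < price n (shiftZ n a b) b := by
  have := shiftZ_nonneg n a b
  unfold price; nlinarith

/-- grid slopes are positive. -/
theorem th_pos (p a : ℕ) : 1 ≤ th n p a := by
  unfold th
  have h1 : (0 : ℤ) ≤ (2 * n + 4) * p := by positivity
  have h2 : (0 : ℤ) ≤ 2 * a := by positivity
  linarith

/-- `D > 1`. -/
theorem one_lt_bigD : (1 : ℤ) < bigD n := by unfold bigD; push_cast; nlinarith

/-- class `1` always scores strictly below class `2` on the same entry, at positive slopes. -/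
theorem phi_one_lt_phi_two {θ : ℤ} (hθ : 1 ≤ θ) (a b : Fin (n + 1)) : phi n θ a b 1 < phi n θ a b 2 := by
  rw [phi_eq, phi_eq]
  have h1 : vv n a b 2 = pen n (shiftZ n a b) := by unfold vv; rw [if_neg (by decide)]; ring
  have h2 : vv n a b 1 = pen n (shiftZ n a b) + price n (shiftZ n a b) b := by unfold vv; rw [if_pos rfl]
  rw [h1, h2, dd_one, dd_two]
  have h3 := price_pos n a b
  have h4 := one_lt_bigD n
  push_cast
  nlinarith

variable {n}

/-- the grid class of a column is its wrap class unless it is `1`. -/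
theorem lam_eq_wrapClass {p a : ℕ} (hp : p ≤ n) (ha : a + p ≤ n + 1) (b : Fin (n + 1)) (h : lam n p a b ≠ 1) :
    lam n p a b = if ((rot n p b : Fin (n + 1)) : ℕ) < (b : ℕ) then 2 else 0 := by
  have hw := wrap_iff_two_of_ee n (ee_cterm_ne_zero n p a hp ha b)
  by_cases hlt : ((rot n p b : Fin (n + 1)) : ℕ) < (b : ℕ)
  · rw [if_pos hlt]; exact hw.mp hlt
  · rw [if_neg hlt]
    have h2 : lam n p a b ≠ 2 := fun h2 => hlt (hw.mpr h2)
    revert h h2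
    generalize lam n p a b = l
    intro h h2
    fin_cases l
    · rfl
    · exact absurd rfl h
    · exact absurd rfl h2

end TwoPort

end BoundarySector

end Summit.ValiantsHypothesis.ValiantsHypothesis.Theorems.KPlusLogSqLaw
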